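import Mathlib.Analysis.InnerProductSpace.Dual
import Mathlib.Analysis.Calculus.Gradient.Basic
import Mathlib.Analysis.Calculus.LocalExtr.Basic
import Mathlib.Topology.MetricSpace.Bounded
import Mathlib.Analysis.Normed.Module.FiniteDimension
import HarnessLib

/-!
# The upper contact set and the normal mapping (Gilbarg–Trudinger, Lemma 9.2, first half)

The geometric half of the Aleksandrov–Bakelman–Pucci estimate: for a bounded open `Ω`, a
function `u` continuous on `Ω̄`, differentiable in `Ω`, with `u ≤ 0` on `∂Ω` and
`M = u(x₀) > 0` at some `x₀ ∈ Ω`, every slope `p` with `‖p‖·diam Ω̄ < M` is the gradient of `u`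
at a point of the **upper contact set**
`Γ⁺ = {y ∈ Ω | u(x) ≤ u(y) + ⟪∇u(y), x − y⟫ for all x ∈ Ω}`;
hence the normal mapping `∇u` maps `Γ⁺` onto a set containing the ball `B(0, M/diam Ω̄)`.

* `exists_interior_isMaxOn_tilt` — the tilted function `u − ⟪p,·⟫` attains its maximum over
  `Ω̄` at an interior point;
* `upperContactSet`, `mem_upperContactSet_of_tilt` — that point lies in `Γ⁺` with `∇u = p`;
* `ball_subset_gradient_image_upperContactSet` — `B(0, M/d) ⊆ ∇u '' Γ⁺`.

The measure half (`ω_n (M/d)ⁿ ≤ ∫_{Γ⁺} |det D²u|`, via Mathlib's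
`MeasureTheory.addHaar_image_le_lintegral_abs_det_fderiv`) and Lemma 9.3 / Thm. 9.1 (with the
det–trace inequality `Literature.Analysis.Matrix.ABP.det_mul_det_le_pow_trace`) follow in
sibling files; the whole feeds the Krylov–Safonov weak Harnack inequality (Thm. 9.22) needed for
the Evans–Krylov step of `Literature.Geometry.Riemannian.gurskyViaclovsky_pathClosed_weighted_four`.

## References

* D. Gilbarg, N. S. Trudinger, *Elliptic Partial Differential Equations of Second Order* (2001),
  §9.1, Lemma 9.2 and its proof (the normal mapping `χ` and `χ(Γ⁺) ⊇ B_{M/d}`).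
  [GilbargTrudinger2001]
-/

noncomputable section

open Set Metric RealInnerProductSpace
open scoped Topology

namespace Literature.Analysis.PDE.ABP

variable {E : Type*} [NormedAddCommGroup E] [InnerProductSpace ℝ E] [CompleteSpace E]

/-- **The upper contact set** of `u` on `Ω` (for differentiable `u`: the points where the graph
lies below its tangent plane over all of `Ω`).
[cite: GilbargTrudinger2001, §9.1 (definition of `Γ⁺`)] -/
def upperContactSet (u : E → ℝ) (Ω : Set E) : Set E :=
  {y ∈ Ω | ∀ x ∈ Ω, u x ≤ u y + ⟪gradient u y, x - y⟫}

/-- Unfolding lemma for `upperContactSet`. [folklore] -/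
theorem mem_upperContactSet {u : E → ℝ} {Ω : Set E} {y : E} :
    y ∈ upperContactSet u Ω ↔ y ∈ Ω ∧ ∀ x ∈ Ω, u x ≤ u y + ⟪gradient u y, x - y⟫ := Iff.rfl

/-- The upper contact set is contained in `Ω`. [folklore] -/
theorem upperContactSet_subset (u : E → ℝ) (Ω : Set E) : upperContactSet u Ω ⊆ Ω :=
  fun _ hy ↦ hy.1

omit [CompleteSpace E] in
/-- **The tilted function attains its maximum in the interior.** For a bounded open `Ω`,
`u` continuous on `Ω̄` with `u ≤ 0` on `∂Ω`, `x₀ ∈ Ω` with `u x₀ > 0` and a slope `p` with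
`‖p‖ · diam Ω̄ < u x₀`, the function `u − ⟪p, ·⟫` has a maximum over `Ω̄` at a point of `Ω`.
[cite: GilbargTrudinger2001, §9.1, proof of Lemma 9.2] -/
theorem exists_interior_isMaxOn_tilt [ProperSpace E] {Ω : Set E} (hΩo : IsOpen Ω)
    (hΩb : Bornology.IsBounded Ω) {u : E → ℝ} (hu : ContinuousOn u (closure Ω))
    (hbd : ∀ y ∈ frontier Ω, u y ≤ 0) {x₀ : E} (hx₀ : x₀ ∈ Ω) {p : E}
    (hp : ‖p‖ * diam (closure Ω) < u x₀) :
    ∃ y ∈ Ω, IsMaxOn (fun x ↦ u x - ⟪p, x⟫) (closure Ω) y := by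
  have hK : IsCompact (closure Ω) := hΩb.isCompact_closure
  have hne : (closure Ω).Nonempty := ⟨x₀, subset_closure hx₀⟩
  have hφ : ContinuousOn (fun x ↦ u x - ⟪p, x⟫) (closure Ω) :=
    hu.sub (continuous_const.inner continuous_id).continuousOn
  obtain ⟨y, hy, hmax⟩ := hK.exists_isMaxOn hne hφ
  refine ⟨y, ?_, hmax⟩
  -- `y` is not on the boundary
  by_contra hyΩ
  have hyfr : y ∈ frontier Ω := by
    rw [frontier, hΩo.interior_eq]; exact ⟨hy, hyΩ⟩
  have h1 : u x₀ - ⟪p, x₀⟫ ≤ u y - ⟪p, y⟫ := hmax (subset_closure hx₀)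
  have h2 : ⟪p, x₀⟫ - ⟪p, y⟫ ≤ ‖p‖ * diam (closure Ω) := by
    rw [← inner_sub_right]
    calc ⟪p, x₀ - y⟫ ≤ ‖p‖ * ‖x₀ - y‖ := real_inner_le_norm _ _
      _ ≤ ‖p‖ * diam (closure Ω) := by
          refine mul_le_mul_of_nonneg_left ?_ (norm_nonneg _)
          rw [← dist_eq_norm]
          exact dist_le_diam_of_mem hK.isBounded (subset_closure hx₀) hy
  linarith [hbd y hyfr]

/-- **The interior maximum point of the tilted function is an upper contact point with
`∇u = p`.** [cite: GilbargTrudinger2001, §9.1, proof of Lemma 9.2] -/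
theorem mem_upperContactSet_of_tilt {Ω : Set E} (hΩo : IsOpen Ω) {u : E → ℝ} {p y : E}
    (hy : y ∈ Ω) (hmax : IsMaxOn (fun x ↦ u x - ⟪p, x⟫) (closure Ω) y)
    (hdiff : DifferentiableAt ℝ u y) :
    y ∈ upperContactSet u Ω ∧ gradient u y = p := by
  -- Fermat: the tilted function has a local max at the interior point `y`
  have hloc : IsLocalMax (fun x ↦ u x - ⟪p, x⟫) y :=
    (hmax.on_subset subset_closure).isLocalMax (hΩo.mem_nhds hy)
  have hgu : HasFDerivAt u (InnerProductSpace.toDual ℝ E (gradient u y)) y :=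
    hasGradientAt_iff_hasFDerivAt.1 hdiff.hasGradientAt
  have hfun : (fun x : E ↦ ⟪p, x⟫) = ⇑(InnerProductSpace.toDual ℝ E p) := by
    funext x; simp
  have hgp : HasFDerivAt (fun x : E ↦ ⟪p, x⟫) (InnerProductSpace.toDual ℝ E p) y := by
    rw [hfun]; exact (InnerProductSpace.toDual ℝ E p).hasFDerivAt
  have hgφ : HasFDerivAt (fun x ↦ u x - ⟪p, x⟫)
      (InnerProductSpace.toDual ℝ E (gradient u y) - InnerProductSpace.toDual ℝ E p) y :=
    hgu.sub hgp
  have hzero := hloc.hasFDerivAt_eq_zero hgφ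
  have hgrad : gradient u y = p :=
    (InnerProductSpace.toDual ℝ E).injective (sub_eq_zero.1 hzero)
  refine ⟨⟨hy, fun x hx ↦ ?_⟩, hgrad⟩
  have h : u x - ⟪p, x⟫ ≤ u y - ⟪p, y⟫ := hmax (subset_closure hx)
  rw [hgrad, inner_sub_right]
  linarith

/-- **The normal mapping covers a ball** (Gilbarg–Trudinger, Lemma 9.2, geometric half): under
the hypotheses of `exists_interior_isMaxOn_tilt` with `u` differentiable on `Ω`, every slope
`p` with `‖p‖ < u(x₀)/diam Ω̄` is `∇u(y)` for some `y ∈ Γ⁺`, i.e.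
`B(0, u(x₀)/diam Ω̄) ⊆ ∇u '' Γ⁺`. [cite: GilbargTrudinger2001, §9.1, Lemma 9.2] -/
theorem ball_subset_gradient_image_upperContactSet [ProperSpace E] {Ω : Set E} (hΩo : IsOpen Ω)
    (hΩb : Bornology.IsBounded Ω) {u : E → ℝ} (hu : ContinuousOn u (closure Ω))
    (hdiff : ∀ y ∈ Ω, DifferentiableAt ℝ u y) (hbd : ∀ y ∈ frontier Ω, u y ≤ 0) {x₀ : E}
    (hx₀ : x₀ ∈ Ω) (hd : 0 < diam (closure Ω)) :
    ball (0 : E) (u x₀ / diam (closure Ω)) ⊆ gradient u '' upperContactSet u Ω := by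
  intro p hp
  rw [mem_ball_zero_iff, lt_div_iff₀ hd] at hp
  obtain ⟨y, hy, hmax⟩ := exists_interior_isMaxOn_tilt hΩo hΩb hu hbd hx₀ hp
  obtain ⟨hyΓ, hgrad⟩ := mem_upperContactSet_of_tilt hΩo hy hmax (hdiff y hy)
  exact ⟨y, hyΓ, hgrad⟩

/-- On the upper contact set the graph lies below the tangent plane, so second differences are
`≤ 0`: `u(y + v) + u(y − v) ≤ 2u(y)` for `y ± v ∈ Ω` (for `C²` functions: `D²u(y) ≤ 0`).
[cite: GilbargTrudinger2001, §9.1 (`D²u ≤ 0` on `Γ⁺`)] -/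
theorem second_difference_nonpos_of_mem_upperContactSet {u : E → ℝ} {Ω : Set E} {y v : E}
    (hy : y ∈ upperContactSet u Ω) (h₁ : y + v ∈ Ω) (h₂ : y - v ∈ Ω) :
    u (y + v) + u (y - v) ≤ 2 * u y := by
  have ha := hy.2 _ h₁
  have hb := hy.2 _ h₂
  rw [add_sub_cancel_left] at ha
  rw [sub_sub_cancel_left, inner_neg_right] at hb
  linarith

end Literature.Analysis.PDE.ABP

end
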